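import Summits.NavierStokesRegularity.NavierStokesRegularity.Theorems.StrainDoorsDefectLifespan
import Summits.NavierStokesRegularity.NavierStokesRegularity.Theorems.StrainDoorsLocalNewton
import HarnessLib

/-!
# StrainDoorsDefectLifespanDoor — door D12 «DefectLifespanDoor»: text, closer, law, D5 ⊆ D12 (part 2 of 2; nsreg-p1 g34, ROUND-50)

Part 2 of 2 (§3–§4) of p1's `r50/` text; imports part 1 `…Theorems.StrainDoorsDefectLifespan` (§1 Bihari lemma, §2 the
defect Riccati bound `strain_le_of_defect`).  The shared module docstring follows.

Door D5 `BudgetedParityDoor` (p1 ROUND-39, CLOSED `budgetedParityDoor_holds`) charges the strain feed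
`H = ¼(|ω|² − ω_e²) − ∇²p(e,e)` at the `δ`-almost strain maximisers above a level `l₀` with PARITY UP TO AN INTEGRABLE
BUDGET, `H ≤ q² + b(t)·q`, and concludes continuation.  This file treats the complementary, physically generic case of a
PARITY DEFECT: `H ≤ c·q² + b(t)·q` with a constant `c ≥ 1` (`c − 1` = the relative super-parity excess of the feed over
the restricted-Euler self-depletion `−q²`).  The growth law at a charged crossing point is then SUPER-LINEAR,
`∂ₜq ≤ (c − 1)q² + (b + η(ε))q`, which the tree's linear threshold device E2_S♭-lin
(`strainThresholdAlmostLinear_holds`) cannot take as it stands.  THE NEW MOVE is a bootstrap: the slope is frozen to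
`(c − 1)·g(s)` with `g` a CONTINUOUS A-PRIORI MAJORANT of the strain form (the supremum over a large compact set of
positions × unit directions, continuous by `IsCompact.continuous_sSup`, glued with the uniform spatial decay
`gradientUniformDecay_holds`), the device is run with the barrier `B = Λ₀·e^{Φ}·exp((c−1)∫g)`, and the resulting
integral inequality `g ≤ Λ₀e^{β}·exp((c−1)∫g)` is closed by an exact Bihari/Riccati comparison (§1).  Results:

* §1 `exp_mul_integral_le_of_bootstrap` — the real-variable Riccati-from-Grönwall lemma (exact constant).
* §2 `strain_le_of_defect` — **THE DEFECT RICCATI BOUND** (PROVED, Sobolev frame of D5): if `⟪∇u(t₀)e,e⟫ ≤ Λ₀`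
  (`0 < Λ₀`, `l₀ ≤ Λ₀`) and the budgeted `c`-parity holds at the charged almost-maximisers on `[t₀,T)`, then for every
  `t ∈ [t₀,T)` with `(c−1)Λ₀e^{β}(t − t₀) < 1`:  `⟪∇u(t,x)e,e⟫ ≤ Λ₀e^{β} / (1 − (c−1)Λ₀e^{β}(t − t₀))`.
* §3 `DefectLifespanDoor` (door D12, text) and `defectLifespanDoor_holds` (CLOSED): if moreover
  `(c−1)Λ₀e^{β}(T − t₀) < 1`, the solution continues past `T`.  Equivalently (`defect_lifespan_law`): a blow-up at `T`
  forces `(c − 1)·Λ₀·e^{β}·(T − t₀) ≥ 1` on EVERY window `[t₀,T)` — the LIFESPAN from `t₀` is at least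
  `1/((c−1)e^{β}Λ(t₀))`, i.e. the parity defect `c − 1` is bounded below by the inverse strain-Type-I number
  `e^{−β}/(Λ(t₀)(T − t₀))`.
* §4 `budgetedParityDoor_of_defectLifespanDoor : DefectLifespanDoor → BudgetedParityDoor` — D5 is the case `c = 1`
  (the a-priori `Λ₀` always exists in the Sobolev frame), so D12 ⊋ D5 as a door text; and the restricted-Euler reading
  `defectLifespan_restrictedEuler` (`b ≡ 0`, `β = 0`: lifespan `≥ 1/((c−1)Λ₀)`, the Vieillefosse clock slowed by the
  factor `1/(c−1)`).

* §5 `localDefectLifespan` / `localDefectLifespan_holds` — the PRESSURE-FREE windowed form: D12 behind D8's splitting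
  plate R (`localNewtonSplits_holds`) with any smoothing budget; the budget enters only as the factor `e^{β/l₀}`.

Dependencies: E1_S♭ `strainGrowthWeighted`, F_S `strainFrame_holds`, E2_S♭-lin `strainThresholdAlmostLinear_holds`,
D_S `gradientUniformDecay_holds`, door Λ `subcriticalStrainDoor_holds`, the Sobolev sup bounds
`exists_forall_norm_le_of_hasBoundedSobolevNormsOn` / `exists_forall_norm_iteratedFDeriv_le_of_hasBoundedSobolevNormsOn`
— all in the tree, so everything here is UNCONDITIONAL (std axioms).

HONEST LABEL: a conditional continuation criterion and its quantitative form (variant of D5/D6 in the door census of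
ROUND-49 §(4); the NEW content is the super-linear branch `c > 1`, which the fixed-scale census lacked, and its reading
as a LIFESPAN / Type-I law).  WHAT THIS IS NOT: items 0056 `NoTypeII`, 10661 and NS regularity are NOT proved; the
Type-I number here is the STRAIN number `Λ(t)(T−t)`, not Leray's `‖u‖_∞√(T−t)`; no Literature fact is a hypothesis;
nothing here is a route or a summit statement (`--supports stmt-NavierStokesRegularity-0056 --as helper`).
-/

noncomputable section

open MeasureTheory Set Function Filter Metric Real InnerProductSpace
open _root_.Topology
open scoped ENNReal NNReal RealInnerProductSpace ContDiff Laplacian Interval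
open Literature.Analysis Literature.Analysis.FluidPDE
open Literature.Analysis.FluidPDE.VorticityDirectionDynamics

set_option linter.dupNamespace false
set_option linter.unusedSectionVars false

namespace Summit.NavierStokesRegularity.NavierStokesRegularity.Theorems.StrainDoors

open Summit.NavierStokesRegularity.NavierStokesRegularity.Theorems.ArgmaxDoors

-- nested operator types (second derivatives)
set_option maxSynthPendingDepth 3

/-! ## §3 Door D12 «DefectLifespanDoor» (text) — CLOSED -/

/-- door D12 «DefectLifespanDoor» (crux-grade text; forward, S38's Sobolev frame = D5's).  Classical unforced solution
on `[0,T)`, `H¹ ∩ Ḣ^m`-bounded on every `[0,T'']`, `T'' < T`; an initial strain bound `⟪∇u(t₀)e,e⟫ ≤ Λ₀`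
(`0 < Λ₀`, `l₀ ≤ Λ₀`); a BUDGET `Φ` on `[t₀,T)` (`Φ(t₀) = 0`, `0 ≤ Φ ≤ β`, `Φ′ = b`); a PARITY DEFECT `c ≥ 1`.
IF at every `δ`-almost strain maximiser charged above `l₀` the strain feed obeys `H ≤ c·q² + b(t)·q` on `[t₀,T)`,
AND the window is short, `(c − 1)·Λ₀e^{β}·(T − t₀) < 1`, THEN the solution extends past `T` in the Sobolev class.
`c = 1` is door D5.  Blow-up at `T` therefore needs `(c − 1)·Λ₀·e^{β}·(T − t₀) ≥ 1` on EVERY window: the parity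
defect is at least the inverse strain-Type-I number. -/
def DefectLifespanDoor : Prop :=
  ∀ (ν T t₀ l₀ δ β c Λ₀ : ℝ) (Φ b : ℝ → ℝ), 0 < ν → 0 ≤ t₀ → t₀ < T → 0 ≤ l₀ → 0 < δ → δ < 1 → 1 ≤ c →
    0 < Λ₀ → l₀ ≤ Λ₀ → Φ t₀ = 0 → (∀ t ∈ Ico t₀ T, 0 ≤ Φ t ∧ Φ t ≤ β ∧ HasDerivAt Φ (b t) t) →
    (c - 1) * (Λ₀ * Real.exp β) * (T - t₀) < 1 →
    ∀ (u : ℝ → (EuclideanSpace ℝ (Fin 3)) → (EuclideanSpace ℝ (Fin 3)))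
      (p : ℝ → (EuclideanSpace ℝ (Fin 3)) → ℝ),
      IsClassicalNSSolutionOn (Ico 0 T) ν 0 u p →
      (∀ T'' < T, HasBoundedSobolevNormsOn (Icc 0 T'') u) →
      (∀ (x e : EuclideanSpace ℝ (Fin 3)), ‖e‖ = 1 → strainQuad u t₀ x e ≤ Λ₀) →
      (∀ t ∈ Ico t₀ T, ∀ (x e : EuclideanSpace ℝ (Fin 3)), IsStrainAlmostArgmax δ u t x e →
        l₀ < strainQuad u t x e →
        strainFeed u p t x e ≤ c * strainQuad u t x e ^ 2 + b t * strainQuad u t x e) →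
      HasSobolevExtensionPast ν u T

/-- **door D12 «DefectLifespanDoor» CLOSED**: the defect Riccati bound is monotone in `t`, hence the strain form is
bounded by `Λ₀e^{β}/(1 − (c−1)Λ₀e^{β}(T − t₀))` on `[t₀,T)`, and door Λ `subcriticalStrainDoor_holds` (`y₀ = ½`)
extends. [folklore] -/
theorem defectLifespanDoor_holds : DefectLifespanDoor := by
  intro ν T t₀ l₀ δ β c Λ₀ Φ b hν ht₀ ht₀T hl₀ hδ hδ1 hc hΛ₀ hlΛ hΦ0 hΦ hsmall u p hsol hreg hinit hhyp
  set A : ℝ := Λ₀ * Real.exp β with hA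
  have hA0 : 0 < A := mul_pos hΛ₀ (Real.exp_pos β)
  have hκ0 : 0 ≤ c - 1 := by linarith
  have hden : 0 < 1 - (c - 1) * A * (T - t₀) := by linarith
  set M'' : ℝ := A * (1 - (c - 1) * A * (T - t₀))⁻¹ with hM''
  have hM''pos : 0 < M'' := mul_pos hA0 (inv_pos.2 hden)
  -- the uniform bound on `[t₀,T)`
  have hbound : ∀ t ∈ Ico t₀ T, ∀ (x e : EuclideanSpace ℝ (Fin 3)), ‖e‖ = 1 → strainQuad u t x e ≤ M'' := by
    intro t ht x e he
    have hmono : (c - 1) * A * (t - t₀) ≤ (c - 1) * A * (T - t₀) :=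
      mul_le_mul_of_nonneg_left (by linarith [ht.2]) (mul_nonneg hκ0 hA0.le)
    have hsm : (c - 1) * A * (t - t₀) < 1 := lt_of_le_of_lt hmono hsmall
    have hq := strain_le_of_defect hν ht₀ ht₀T hδ hδ1 hc hΛ₀ hlΛ hΦ0 hΦ hsol hreg hinit hhyp t ht hsm x e he
    have hdt : 0 < 1 - (c - 1) * A * (t - t₀) := by linarith
    have hinv : (1 - (c - 1) * A * (t - t₀))⁻¹ ≤ (1 - (c - 1) * A * (T - t₀))⁻¹ :=
      inv_anti₀ hden (by linarith)
    exact hq.trans (mul_le_mul_of_nonneg_left hinv hA0.le)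
  -- door Λ with `y₀ = 1/2` on `[t₁, T)`
  set t₁ : ℝ := max t₀ (T - 1 / (2 * M'')) with ht₁
  have ht₁0 : 0 ≤ t₁ := ht₀.trans (le_max_left _ _)
  have ht₁T : t₁ < T := by
    rw [ht₁]
    refine max_lt ht₀T ?_
    have := div_pos one_pos (mul_pos two_pos hM''pos)
    linarith
  refine subcriticalStrainDoor_holds ν T t₁ (1 / 2) hν ht₁0 ht₁T (by norm_num) u p hsol hreg ?_
  intro t ht x e he
  have hq := hbound t ⟨(le_max_left _ _).trans ht.1, ht.2⟩ x e he
  have hTt : T - t ≤ 1 / (2 * M'') := by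
    have := (le_max_right t₀ (T - 1 / (2 * M''))).trans ht.1
    linarith
  have hTt0 : 0 < T - t := sub_pos.2 ht.2
  calc (T - t) * strainQuad u t x e ≤ (T - t) * M'' := mul_le_mul_of_nonneg_left hq hTt0.le
    _ ≤ 1 / (2 * M'') * M'' := mul_le_mul_of_nonneg_right hTt hM''pos.le
    _ = 1 / 2 := by field_simp

/-- **THE DEFECT–LIFESPAN LAW** (door D12 read as a necessary condition for blow-up): if the solution does NOT extend
past `T`, then on every window `[t₀,T)` carrying an initial strain bound `Λ₀` and the budgeted `c`-parity,
`1 ≤ (c − 1)·Λ₀e^{β}·(T − t₀)` — the parity defect `c − 1` is at least `e^{−β}/(Λ₀(T − t₀))`. [folklore] -/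
theorem defect_lifespan_law {ν T t₀ l₀ δ β c Λ₀ : ℝ} {Φ b : ℝ → ℝ} (hν : 0 < ν) (ht₀ : 0 ≤ t₀) (ht₀T : t₀ < T)
    (hl₀ : 0 ≤ l₀) (hδ : 0 < δ) (hδ1 : δ < 1) (hc : 1 ≤ c) (hΛ₀ : 0 < Λ₀) (hlΛ : l₀ ≤ Λ₀) (hΦ0 : Φ t₀ = 0)
    (hΦ : ∀ t ∈ Ico t₀ T, 0 ≤ Φ t ∧ Φ t ≤ β ∧ HasDerivAt Φ (b t) t)
    {u : ℝ → (EuclideanSpace ℝ (Fin 3)) → (EuclideanSpace ℝ (Fin 3))} {p : ℝ → (EuclideanSpace ℝ (Fin 3)) → ℝ}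
    (hsol : IsClassicalNSSolutionOn (Ico 0 T) ν 0 u p) (hreg : ∀ T'' < T, HasBoundedSobolevNormsOn (Icc 0 T'') u)
    (hinit : ∀ (x e : EuclideanSpace ℝ (Fin 3)), ‖e‖ = 1 → strainQuad u t₀ x e ≤ Λ₀)
    (hhyp : ∀ t ∈ Ico t₀ T, ∀ (x e : EuclideanSpace ℝ (Fin 3)), IsStrainAlmostArgmax δ u t x e →
      l₀ < strainQuad u t x e → strainFeed u p t x e ≤ c * strainQuad u t x e ^ 2 + b t * strainQuad u t x e)
    (hblow : ¬ HasSobolevExtensionPast ν u T) :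
    1 ≤ (c - 1) * (Λ₀ * Real.exp β) * (T - t₀) := by
  by_contra h
  push Not at h
  exact hblow (defectLifespanDoor_holds ν T t₀ l₀ δ β c Λ₀ Φ b hν ht₀ ht₀T hl₀ hδ hδ1 hc hΛ₀ hlΛ hΦ0 hΦ h u p
    hsol hreg hinit hhyp)

/-! ## §4 D5 is the case `c = 1`; the restricted-Euler reading -/

/-- **D12 ⊇ D5**: door D5 `BudgetedParityDoor` is door D12 at `c = 1` (the a-priori bound `Λ₀ := max M l₀ + 1` of the
strain form at `t₀` always exists in the Sobolev frame; the window condition is `0 < 1`). [folklore] -/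
theorem budgetedParityDoor_of_defectLifespanDoor (h : DefectLifespanDoor) : BudgetedParityDoor := by
  intro ν T t₀ l₀ δ β Φ b hν ht₀ ht₀T hl₀ hδ hδ1 hΦ0 hΦ u p hsol hreg hhyp
  -- the strain form at `t₀` is bounded
  obtain ⟨M, -, hM⟩ : ∃ M : ℝ, 0 ≤ M ∧
      ∀ (x e : EuclideanSpace ℝ (Fin 3)), ‖e‖ = 1 → strainQuad u t₀ x e ≤ M := by
    set T'' : ℝ := (t₀ + T) / 2 with hT''
    have hT''T : T'' < T := by rw [hT'']; linarith
    have ht₀T'' : t₀ ≤ T'' := by rw [hT'']; linarith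
    have hsm : ∀ r ∈ Icc 0 T'', ContDiff ℝ ∞ (u r) := fun r hr =>
      hsol.contDiff_velocity ⟨hr.1, lt_of_le_of_lt hr.2 hT''T⟩
    obtain ⟨C1, hC1⟩ :=
      exists_forall_norm_iteratedFDeriv_le_of_hasBoundedSobolevNormsOn hsm (hreg T'' hT''T) 1
    refine ⟨max C1 0, le_max_right _ _, fun x e he => ?_⟩
    have h := hC1 t₀ ⟨ht₀, ht₀T''⟩ x
    rw [norm_iteratedFDeriv_one] at h
    exact ((strainQuad_le_opNorm u t₀ x he).trans h).trans (le_max_left _ _)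
  set Λ₀ : ℝ := max M l₀ + 1 with hΛ₀
  have hΛM : M ≤ Λ₀ := by rw [hΛ₀]; linarith [le_max_left M l₀]
  have hΛl : l₀ ≤ Λ₀ := by rw [hΛ₀]; linarith [le_max_right M l₀]
  have hΛpos : 0 < Λ₀ := by rw [hΛ₀]; linarith [le_max_right M l₀]
  refine h ν T t₀ l₀ δ β 1 Λ₀ Φ b hν ht₀ ht₀T hl₀ hδ hδ1 le_rfl hΛpos hΛl hΦ0 hΦ (by simp) u p hsol hreg
    (fun x e he => (hM x e he).trans hΛM) ?_
  intro t ht x e hax hq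
  have := hhyp t ht x e hax hq
  simpa [one_mul] using this

/-- **The restricted-Euler reading** (no budget: `Φ ≡ 0`, `b ≡ 0`, `β = 0`): with a pure parity defect `c ≥ 1` at the
charged almost-maximisers and `⟪∇u(t₀)e,e⟫ ≤ Λ₀`, the solution lives at least `1/((c−1)Λ₀)` beyond `t₀` — the
Vieillefosse finite-time clock of restricted Euler (`∂ₜq = q²`-type blow-up after `∼1/Λ₀`) slowed by the factor
`1/(c−1)`. [folklore] -/
theorem defectLifespan_restrictedEuler {ν T t₀ l₀ δ c Λ₀ : ℝ} (hν : 0 < ν) (ht₀ : 0 ≤ t₀) (ht₀T : t₀ < T)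
    (hl₀ : 0 ≤ l₀) (hδ : 0 < δ) (hδ1 : δ < 1) (hc : 1 ≤ c) (hΛ₀ : 0 < Λ₀) (hlΛ : l₀ ≤ Λ₀)
    (hsmall : (c - 1) * Λ₀ * (T - t₀) < 1)
    {u : ℝ → (EuclideanSpace ℝ (Fin 3)) → (EuclideanSpace ℝ (Fin 3))} {p : ℝ → (EuclideanSpace ℝ (Fin 3)) → ℝ}
    (hsol : IsClassicalNSSolutionOn (Ico 0 T) ν 0 u p) (hreg : ∀ T'' < T, HasBoundedSobolevNormsOn (Icc 0 T'') u)
    (hinit : ∀ (x e : EuclideanSpace ℝ (Fin 3)), ‖e‖ = 1 → strainQuad u t₀ x e ≤ Λ₀)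
    (hhyp : ∀ t ∈ Ico t₀ T, ∀ (x e : EuclideanSpace ℝ (Fin 3)), IsStrainAlmostArgmax δ u t x e →
      l₀ < strainQuad u t x e → strainFeed u p t x e ≤ c * strainQuad u t x e ^ 2) :
    HasSobolevExtensionPast ν u T := by
  refine defectLifespanDoor_holds ν T t₀ l₀ δ 0 c Λ₀ (fun _ => 0) (fun _ => 0) hν ht₀ ht₀T hl₀ hδ hδ1 hc hΛ₀
    hlΛ rfl (fun t _ => ⟨le_rfl, le_rfl, hasDerivAt_const t 0⟩) (by simpa using hsmall) u p hsol hreg hinit ?_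
  intro t ht x e hax hq
  have := hhyp t ht x e hax hq
  simpa using this

/-! ## §5 The windowed (pressure-free) form: D12 behind D8's splitting -/

/-- **THE LOCAL DEFECT–LIFESPAN BOUND** (D12 composed with D8's splitting plate R `LocalNewtonSplits`, PROVED in the
tree as `localNewtonSplits_holds`, and ANY smoothing budget `|smoothingTerm| ≤ b`, `Φ' = b`, `0 ≤ Φ ≤ β` on `[t₀,T)` —
plate B `SmoothingBudget` supplies one in the energy class).  If at the charged almost-maximisers the PRESSURE-FREE
windowed near feed has defect `c ≥ 1`, `newtonNearFeed_{r₀r₁} ≤ c·q²`, and `(c−1)·Λ₀·e^{β/l₀}·(T − t₀) < 1`, the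
solution continues past `T`: the smoothing budget enters only through the factor `e^{β/l₀}`. [folklore] -/
theorem localDefectLifespan (hR : LocalNewtonSplits) {ν T t₀ l₀ δ r₀ r₁ c Λ₀ β : ℝ} {Φ b : ℝ → ℝ} (hν : 0 < ν)
    (ht₀ : 0 ≤ t₀) (hT : t₀ < T) (hl₀ : 0 < l₀) (hδ : 0 < δ) (hδ1 : δ < 1) (hr₀ : 0 < r₀) (hr₁ : r₀ < r₁)
    (hc : 1 ≤ c) (hΛ₀ : 0 < Λ₀) (hlΛ : l₀ ≤ Λ₀) (hΦ0 : Φ t₀ = 0)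
    (hΦ : ∀ t ∈ Ico t₀ T, 0 ≤ Φ t ∧ Φ t ≤ β ∧ HasDerivAt Φ (b t) t)
    {u : ℝ → (EuclideanSpace ℝ (Fin 3)) → (EuclideanSpace ℝ (Fin 3))} {p : ℝ → (EuclideanSpace ℝ (Fin 3)) → ℝ}
    (hsol : IsClassicalNSSolutionOn (Ico 0 T) ν 0 u p) (hSob : ∀ T'' < T, HasBoundedSobolevNormsOn (Icc 0 T'') u)
    (hfar : ∀ t ∈ Ico t₀ T, ∀ (x e : EuclideanSpace ℝ (Fin 3)), ‖e‖ = 1 → |smoothingTerm r₀ r₁ p t x e| ≤ b t)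
    (hinit : ∀ (x e : EuclideanSpace ℝ (Fin 3)), ‖e‖ = 1 → strainQuad u t₀ x e ≤ Λ₀)
    (hnear : ∀ t ∈ Ico t₀ T, ∀ (x e : EuclideanSpace ℝ (Fin 3)), IsStrainAlmostArgmax δ u t x e →
      l₀ < strainQuad u t x e → newtonNearFeed r₀ r₁ u t x e ≤ c * strainQuad u t x e ^ 2)
    (hsmall : (c - 1) * (Λ₀ * Real.exp (β / l₀)) * (T - t₀) < 1) :
    HasSobolevExtensionPast ν u T := by
  refine defectLifespanDoor_holds ν T t₀ l₀ δ (β / l₀) c Λ₀ (fun t => Φ t / l₀) (fun t => b t / l₀) hν ht₀ hT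
    hl₀.le hδ hδ1 hc hΛ₀ hlΛ (by simp [hΦ0]) ?_ hsmall u p hsol hSob hinit ?_
  · intro t ht
    obtain ⟨h0, hβ, hd⟩ := hΦ t ht
    exact ⟨div_nonneg h0 hl₀.le, div_le_div_of_nonneg_right hβ hl₀.le, hd.div_const l₀⟩
  · intro t ht x e hax hq
    have he : ‖e‖ = 1 := hax.1
    have ht' : t ∈ Ico 0 T := ⟨ht₀.trans ht.1, ht.2⟩
    have hsplit := hR ν T u p hν hsol hSob t ht' r₀ r₁ hr₀ hr₁ x e
    have hfb := hfar t ht x e he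
    have hn := hnear t ht x e hax hq
    have h1 : -smoothingTerm r₀ r₁ p t x e ≤ b t := le_trans (neg_le_abs _) hfb
    have hb0 : 0 ≤ b t := le_trans (abs_nonneg _) hfb
    have h2 : b t ≤ b t / l₀ * strainQuad u t x e := by
      rw [div_mul_eq_mul_div, le_div_iff₀ hl₀]
      exact mul_le_mul_of_nonneg_left hq.le hb0
    rw [hsplit]
    linarith

/-- The local defect–lifespan bound with plate R discharged BY NAME (`localNewtonSplits_holds`). -/
theorem localDefectLifespan_holds {ν T t₀ l₀ δ r₀ r₁ c Λ₀ β : ℝ} {Φ b : ℝ → ℝ} (hν : 0 < ν)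
    (ht₀ : 0 ≤ t₀) (hT : t₀ < T) (hl₀ : 0 < l₀) (hδ : 0 < δ) (hδ1 : δ < 1) (hr₀ : 0 < r₀) (hr₁ : r₀ < r₁)
    (hc : 1 ≤ c) (hΛ₀ : 0 < Λ₀) (hlΛ : l₀ ≤ Λ₀) (hΦ0 : Φ t₀ = 0)
    (hΦ : ∀ t ∈ Ico t₀ T, 0 ≤ Φ t ∧ Φ t ≤ β ∧ HasDerivAt Φ (b t) t)
    {u : ℝ → (EuclideanSpace ℝ (Fin 3)) → (EuclideanSpace ℝ (Fin 3))} {p : ℝ → (EuclideanSpace ℝ (Fin 3)) → ℝ}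
    (hsol : IsClassicalNSSolutionOn (Ico 0 T) ν 0 u p) (hSob : ∀ T'' < T, HasBoundedSobolevNormsOn (Icc 0 T'') u)
    (hfar : ∀ t ∈ Ico t₀ T, ∀ (x e : EuclideanSpace ℝ (Fin 3)), ‖e‖ = 1 → |smoothingTerm r₀ r₁ p t x e| ≤ b t)
    (hinit : ∀ (x e : EuclideanSpace ℝ (Fin 3)), ‖e‖ = 1 → strainQuad u t₀ x e ≤ Λ₀)
    (hnear : ∀ t ∈ Ico t₀ T, ∀ (x e : EuclideanSpace ℝ (Fin 3)), IsStrainAlmostArgmax δ u t x e →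
      l₀ < strainQuad u t x e → newtonNearFeed r₀ r₁ u t x e ≤ c * strainQuad u t x e ^ 2)
    (hsmall : (c - 1) * (Λ₀ * Real.exp (β / l₀)) * (T - t₀) < 1) :
    HasSobolevExtensionPast ν u T :=
  localDefectLifespan localNewtonSplits_holds hν ht₀ hT hl₀ hδ hδ1 hr₀ hr₁ hc hΛ₀ hlΛ hΦ0 hΦ hsol hSob hfar hinit
    hnear hsmall

end Summit.NavierStokesRegularity.NavierStokesRegularity.Theorems.StrainDoors

end
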